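import Literature.NumberTheory.Automorphic.QuaternionUnitsMultiplicityOneOfSliceComparison
import Literature.NumberTheory.Automorphic.IntegratedOperatorStar
import HarnessLib

/-!
# Multiplicity one for `D^×` from a matched family of test functions: the operator theory of
# Gelbart's proof of Thm. 10.5 applied to Thm. 10.10
(Gelbart, *Automorphic forms on adele groups* (1975), §10, pp. 151–155 and Thm. 10.10, p. 158;
Jacquet–Langlands, LNM 114 (1970), §16, Lemma 16.1.1)

Topic `NumberTheory/Automorphic`; theorems only (no definition, no named fact, no instance). Part
of the inline (D-0026) decomposition of the named fact
`Literature.NumberTheory.Automorphic.multiplicity_one_quaternionUnits K D` (`JacquetLanglandsParts`,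
Gelbart Thm. 10.10). The assembled operator-level form of that theorem in the tree,
`multiplicity_one_quaternionUnits_of_sliceComparison` (`QuaternionUnitsMultiplicityOneOfSliceComparison`),
consumes a family `B` of pairs of bounded operators on `L²(GL₂)` and `L²(D_𝔸ˣ ⧸ ℝ_{>0} Dˣ)` —
closed under products and adjoints, in the bicommutants, compatible with the idempotents
`E₁ = R(ξ_S)`, `E₂ = R'(ξ'_S)`, approximating the complementary groups, and carrying the
Hilbert–Schmidt inequality. In Gelbart's proof `B` consists of the pairs
`(R₀(Φ_f), R'(Φ'_f))`, `Φ_f = ξ_S ⊗ f`, `Φ'_f = ξ'_S ⊗ f`, `f ∈ S(G_S)` (p. 153), i.e. of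
`(E₁ R(f), E₂ R'(f))` with `R(f)`, `R'(f)` the integrated operators of the complementary groups
`G_S ≅ G'_S` acting on the two `L²` spaces. This file performs that passage from test functions to
operators, using the `*`-representation property of the integrated representation
(`IntegratedOperatorStar`: `π(f₁) π(f₂) = π(f₁ ⋆ f₂)`, `π(f)^* = π(f^*)`), so that what is asked of
the trace-formula side is stated on test functions:

* `ContRepresentation.norm_integratedOperator_apply_sub_smul_le`,
  `ContRepresentation.norm_integratedOperator_apply_sub_le_of_integral_eq_one` — **Dirac-function
  estimate at a base point** (Deitmar–Echterhoff (2014), Lemma 6.2.2): for real non-negative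
  `f ∈ C_c(G)` of integral one supported where `‖π(g) v - π(g₀) v‖ ≤ δ`, `‖π(f) v - π(g₀) v‖ ≤ δ`;
  this discharges the approximation hypotheses of the operator-level theorem from the existence
  of approximate identities among the test functions.
* `not_isOrtho_of_testFamily` — **abstract form**: unitary `τ₁`, `τ₂` of `Γ₁`, `Γ₂` on `H₁`, `H₂`;
  locally compact second countable groups `𝔊₁`, `𝔊₂` with left- and inversion-invariant measures
  and homomorphisms `ιᵢ : 𝔊ᵢ → Γᵢ` along which `τᵢ` is strongly continuous, `Γᵢ = Kᵢ · ιᵢ(𝔊ᵢ)`;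
  self-adjoint idempotents `Eᵢ` in the bicommutants, commuting with `τᵢ(ιᵢ 𝔊ᵢ)`, with
  `Eᵢ τᵢ(k) y = cᵢ(k) y` on `Eᵢ`-fixed vectors (`k ∈ Kᵢ`); on the first side a closed invariant
  `L` with multiplicity one and atoms, and `M = {y ∈ L : E₁ y = y}`; a `ℂ`-subspace `𝒜` of pairs of
  test functions closed under componentwise convolution and involution, with approximate
  identities on both sides, and the inequality `Σ_j ‖E₂ τ₂(F₂) c_j‖² ≤ Σ_i ‖E₁ τ₁(F₁) b_i‖² < ∞`
  along `𝒜` (Hilbert bases of `H₂` and `M`). Then two irreducible closed `τ₂`-invariant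
  `W₁ ≅ W₂` with a non-zero `E₂`-fixed vector in `W₁` are not orthogonal. Proof: the image `B` of
  `𝒜` under `(F₁, F₂) ↦ (E₁ τ₁(F₁), E₂ τ₂(F₂))` satisfies the hypotheses of
  `not_isOrtho_of_sliceComparison` (`HilbertRepSliceMultiplicityOne`).
* `eq_of_le_cuspidalSubspace_of_areUnitarilyEquivalent`,
  `exists_isTopIrreducible_le_of_le_cuspidalSubspace` — multiplicity one below `L²_cusp(GL_n)`
  from the named fact `multiplicity_one_gl`, and atomicity below `L²_cusp(GL_n)` from the proved
  `AutomorphicGLn.isDiscretelyDecomposable_cuspidal_holds`, transported along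
  `ClosedSubrep.restrictLE` / `inflate`.
* `multiplicity_one_quaternionUnits_of_testFamily` — **`multiplicity_one_quaternionUnits K D`
  from `multiplicity_one_gl 2 K` and, for each pair of equivalent irreducible constituents of
  `L²(D_𝔸ˣ ⧸ ℝ_{>0} Dˣ)` of dimension `≠ 1`, the idempotents (`R(ξ_S)`, `R'(ξ'_S)`; in the tree
  `ContRepresentation.exists_minimalIdempotent_spec`, `HilbertRepMinimalIdempotent`, for arbitrary
  irreducible unitary local types), a non-zero `E₂`-fixed vector in the constituent, Gelbart's
  `M`, and a matched family of test functions with the trace inequality (10.10).**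

What remains under the named fact after this file: the complementary groups with
`GL₂(𝔸_K) = G_{S} · G^S`, `D_𝔸ˣ = G'_{S} · G'^S` (adelic bookkeeping), the local types with a copy
in `π'` (Peter–Weyl for the compact-modulo-centre `G'_S`), the matched test functions
`F₂ = F₁ ∘ θ` with approximate identities, and the inequality of traces
`tr R'(ξ'_S ⊗ F F^*) ≤ tr R(ξ_S ⊗ F F^*)|_M` — the two trace formulas (10.14), (10.15) and their
comparison (10.16)–(10.22) with (10.8) — together with multiplicity one for `GL₂`
(`multiplicity_one_gl`, Gelbart Thm. 5.7). No new definition, no new named fact.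

## References

* S. Gelbart, *Automorphic forms on adele groups*, Ann. of Math. Studies 83 (1975), Thm. 5.7,
  Lemma 10.6, proof of Thm. 10.5 (pp. 151–155), (10.10)–(10.13), Thm. 10.10 (p. 158)
  [Gelbart1975].
* H. Jacquet, R. P. Langlands, *Automorphic forms on GL(2)*, LNM 114 (1970), §16, Lemma 16.1.1
  [JacquetLanglands1970].
* A. Deitmar, S. Echterhoff, *Principles of harmonic analysis*, 2nd ed. (2014), Lemma 6.2.2,
  Prop. 6.2.1 [DeitmarEchterhoff2014].
* I. M. Gelfand, M. I. Graev, I. I. Piatetski-Shapiro, *Representation theory and automorphic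
  functions* (1969), Ch. 3 [GelfandGraevPiatetskiShapiro1969].
-/

noncomputable section

open scoped InnerProductSpace NNReal ENNReal ComplexConjugate
open MeasureTheory Filter Topology CompactlySupported

/-! ### Approximation by integrated operators of functions with small support -/

namespace ContRepresentation

section Approx

variable {G H : Type*} [Group G] [TopologicalSpace G] [MeasurableSpace G] [OpensMeasurableSpace G]
  [NormedAddCommGroup H] [InnerProductSpace ℂ H] [CompleteSpace H]
  {π : ContRepresentation ℂ G H}

/-- **Dirac-function estimate at a point** (Deitmar–Echterhoff (2014), Lemma 6.2.2, general
base point): for a real non-negative `f ∈ C_c(G)` and vectors `v`, `z` with `‖π(g) v - z‖ ≤ δ` on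
the support of `f`, `‖π(f) v - (∫ f) z‖ ≤ δ ∫ f`. With `z = π(g₀) v` and `f` supported near `g₀`
with `∫ f = 1` this says `π(f) v ≈ π(g₀) v`: the integrated operators of an approximate identity
at `g₀` converge strongly to `π(g₀)`. [cite: DeitmarEchterhoff2014, Lemma 6.2.2] -/
theorem norm_integratedOperator_apply_sub_smul_le (hu : π.IsUnitary)
    (hc : π.IsStronglyContinuous) (η : Measure G) [IsFiniteMeasureOnCompacts η] (f : C_c(G, ℂ))
    (hf : ∀ g, 0 ≤ (f g).re ∧ (f g).im = 0) (v z : H) {δ : ℝ}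
    (hδ : ∀ g ∈ tsupport f, ‖π g v - z‖ ≤ δ) :
    ‖π.integratedOperator hu hc η f v - ((∫ g, (f g).re ∂η : ℝ) : ℂ) • z‖ ≤
      δ * ∫ g, (f g).re ∂η := by
  have hfre : ∀ g, (f g : ℂ) = ((f g).re : ℂ) := fun g =>
    Complex.ext (by simp) (by simp [(hf g).2])
  set c : ℝ := ∫ g, (f g).re ∂η with hcdef
  have hcv : ∫ g, f g • z ∂η = (c : ℂ) • z := by
    rw [integral_smul_const, hcdef, ← integral_complex_ofReal]
    congr 1
    exact integral_congr_ae (Eventually.of_forall fun g => hfre g)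
  have hint : Integrable (fun g => (f g).re * δ) η :=
    ((Complex.continuous_re.comp f.continuous).integrable_of_hasCompactSupport
      (f.hasCompactSupport.comp_left Complex.zero_re)).mul_const _
  have hint2 : Integrable (fun g => f g • z) η :=
    (f.continuous.smul continuous_const).integrable_of_hasCompactSupport
      (f.hasCompactSupport.smul_right : HasCompactSupport ((⇑f) • fun _ : G => z))
  rw [integratedOperator_apply, ← hcv, ← integral_sub (integrable_smul_apply hc η f v) hint2]
  calc ‖∫ g, (f g • π g v - f g • z) ∂η‖ ≤ ∫ g, (f g).re * δ ∂η := by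
        refine norm_integral_le_of_norm_le hint (Eventually.of_forall fun g => ?_)
        have hnorm : ‖f g‖ = (f g).re := by
          conv_lhs => rw [hfre g]
          rw [Complex.norm_real, Real.norm_of_nonneg (hf g).1]
        rw [← smul_sub, norm_smul, hnorm]
        by_cases hg : g ∈ tsupport f
        · exact mul_le_mul_of_nonneg_left (hδ g hg) (hf g).1
        · rw [image_eq_zero_of_notMem_tsupport hg]
          simp
    _ = δ * ∫ g, (f g).re ∂η := by rw [integral_mul_const, mul_comm]

/-- **Strong approximation of `π(g₀)` by integrated operators**: for real non-negative
`f ∈ C_c(G)` of integral `1` supported in `{g : ‖π(g) v - π(g₀) v‖ ≤ δ}`,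
`‖π(f) v - π(g₀) v‖ ≤ δ`. [cite: DeitmarEchterhoff2014, Lemma 6.2.2] -/
theorem norm_integratedOperator_apply_sub_le_of_integral_eq_one (hu : π.IsUnitary)
    (hc : π.IsStronglyContinuous) (η : Measure G) [IsFiniteMeasureOnCompacts η] (f : C_c(G, ℂ))
    (hf : ∀ g, 0 ≤ (f g).re ∧ (f g).im = 0) (hf1 : ∫ g, (f g).re ∂η = 1) (v : H) (g₀ : G)
    {δ : ℝ} (hδ : ∀ g ∈ tsupport f, ‖π g v - π g₀ v‖ ≤ δ) :
    ‖π.integratedOperator hu hc η f v - π g₀ v‖ ≤ δ := by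
  have h := norm_integratedOperator_apply_sub_smul_le hu hc η f hf v (π g₀ v) hδ
  rwa [hf1, Complex.ofReal_one, one_smul, mul_one] at h

end Approx

end ContRepresentation

/-! ### The operator datum from a matched family of test functions -/

namespace Literature.NumberTheory.Automorphic

open ContRepresentation

section TestFamily

variable {Γ₁ Γ₂ : Type*} [Group Γ₁] [Group Γ₂]
  {H₁ : Type*} [NormedAddCommGroup H₁] [InnerProductSpace ℂ H₁] [CompleteSpace H₁]
  {H₂ : Type*} [NormedAddCommGroup H₂] [InnerProductSpace ℂ H₂] [CompleteSpace H₂]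
  {𝔊₁ : Type*} [Group 𝔊₁] [TopologicalSpace 𝔊₁] [IsTopologicalGroup 𝔊₁] [MeasurableSpace 𝔊₁]
  [BorelSpace 𝔊₁] [SecondCountableTopology 𝔊₁]
  {𝔊₂ : Type*} [Group 𝔊₂] [TopologicalSpace 𝔊₂] [IsTopologicalGroup 𝔊₂] [MeasurableSpace 𝔊₂]
  [BorelSpace 𝔊₂] [SecondCountableTopology 𝔊₂]

/-- **Gelbart's Thm. 10.10 from a matched family of test functions.** Setting: unitary
representations `τ₁` of `Γ₁` on `H₁` (the `GL(2)` side) and `τ₂` of `Γ₂` on `H₂` (the quaternion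
side); locally compact second countable groups `𝔊₁`, `𝔊₂` with left-invariant, inversion-invariant
measures `η₁`, `η₂` finite on compacts (the complementary groups `G_S ≅ G'_S` with their Haar
measures) and homomorphisms `ιᵢ : 𝔊ᵢ → Γᵢ` along which `τᵢ` is strongly continuous; subsets
`Kᵢ ⊆ Γᵢ` (the ramified components) with `Γᵢ = Kᵢ · ιᵢ(𝔊ᵢ)`; operators `Eᵢ` on `Hᵢ` —
self-adjoint idempotents commuting with the commutant of `τᵢ(Γᵢ)` and with `τᵢ(ιᵢ 𝔊ᵢ)`, and
acting by `Eᵢ τᵢ(k) y = cᵢ(k) y` on `Eᵢ`-fixed vectors for `k ∈ Kᵢ` (Gelbart's `R(ξ_S)`,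
`R'(ξ'_S)`; in the tree `ContRepresentation.exists_minimalIdempotent_spec`); on the `GL(2)` side a
closed invariant `L ≤ H₁` with multiplicity one and atoms below every non-zero closed invariant
subspace (`L²₀`), and `M = {y ∈ L : E₁ y = y}` (Gelbart's `M`, p. 152). Datum: a `ℂ`-subspace `𝒜`
of pairs `(F₁, F₂) ∈ C_c(𝔊₁) × C_c(𝔊₂)` (matched test functions, `F₂ = F₁ ∘ θ` place by place)
closed under componentwise convolution and involution, containing on each side real non-negative
functions of integral one supported in any prescribed open set (approximate identities), such that
**`Σ_j ‖E₂ τ₂(F₂) c_j‖² ≤ Σ_i ‖E₁ τ₁(F₁) b_i‖² < ∞`** for all `(F₁, F₂) ∈ 𝒜`, Hilbert bases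
`(b_i)` of `M` and `(c_j)` of `H₂` — the Hilbert–Schmidt form of
`tr τ'(F * F^*) ≤ tr τ(F * F^*)` (10.10) = (10.12)–(10.22), `τᵢ(F)` denoting the integrated
operators of `τᵢ ∘ ιᵢ`. Conclusion: two irreducible closed `τ₂`-invariant subspaces `W₁ ≅ W₂` of
`H₂` such that `W₁` contains a non-zero `E₂`-fixed vector (`π'_S ≅ σ'_S`) are **not orthogonal**.
Proof: the pairs `(E₁ τ₁(F₁), E₂ τ₂(F₂))`, `(F₁, F₂) ∈ 𝒜`, form a family `B` as required by
`not_isOrtho_of_sliceComparison` — closed under products and adjoints by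
`integratedOperator_comp_integratedOperator`, `adjoint_integratedOperator` (`IntegratedOperatorStar`)
and the commutation of `Eᵢ` with `τᵢ(Fᵢ)`; in the bicommutant by
`comp_integratedOperator_eq_integratedOperator_comp`; the approximation hypotheses by the
Dirac-function estimate `norm_integratedOperator_apply_sub_le_of_integral_eq_one`.
[cite: Gelbart1975, Thm. 10.10 (proof), p. 158, and proof of Thm. 10.5, pp. 151–155;
JacquetLanglands1970, §16, Lemma 16.1.1] -/
theorem not_isOrtho_of_testFamily
    (η₁ : Measure 𝔊₁) [IsFiniteMeasureOnCompacts η₁] [SFinite η₁] [η₁.IsMulLeftInvariant]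
    [η₁.IsInvInvariant]
    (η₂ : Measure 𝔊₂) [IsFiniteMeasureOnCompacts η₂] [SFinite η₂] [η₂.IsMulLeftInvariant]
    [η₂.IsInvInvariant]
    -- the `GL(2)` side
    (τ₁ : ContRepresentation ℂ Γ₁ H₁) (hτ₁ : τ₁.IsUnitary) (ι₁ : 𝔊₁ →* Γ₁)
    (hc₁ : (τ₁.restrict ι₁).IsStronglyContinuous)
    (L : ClosedSubrep τ₁)
    (hMO : ∀ N N' : ClosedSubrep τ₁, N ≤ L → N' ≤ L →
      N.toContRep.IsTopIrreducible → N'.toContRep.IsTopIrreducible →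
      AreUnitarilyEquivalent N.toContRep N'.toContRep → N = N')
    (hatom : ∀ U : ClosedSubrep τ₁, U ≤ L → U ≠ ⊥ →
      ∃ N : ClosedSubrep τ₁, N ≤ U ∧ N.toContRep.IsTopIrreducible)
    (Kset₁ : Set Γ₁) (hgen₁ : ∀ γ : Γ₁, ∃ k ∈ Kset₁, ∃ g : 𝔊₁, γ = k * ι₁ g)
    (E₁ : H₁ →L[ℂ] H₁) (hE₁sa : ∀ u v : H₁, ⟪E₁ u, v⟫_ℂ = ⟪u, E₁ v⟫_ℂ)
    (hE₁idem : ∀ v, E₁ (E₁ v) = E₁ v)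
    (hE₁T : ∀ U : H₁ →L[ℂ] H₁, (∀ γ : Γ₁, U ∘L τ₁ γ = τ₁ γ ∘L U) → U ∘L E₁ = E₁ ∘L U)
    (hE₁ι : ∀ g : 𝔊₁, E₁ ∘L τ₁ (ι₁ g) = τ₁ (ι₁ g) ∘L E₁) (c₁ : Γ₁ → ℂ)
    (hE₁K : ∀ k ∈ Kset₁, ∀ y, E₁ y = y → E₁ (τ₁ k y) = c₁ k • y)
    (M : Submodule ℂ H₁) (hM : ∀ y, y ∈ M ↔ y ∈ L ∧ E₁ y = y)
    {ι : Type*} (b : HilbertBasis ι ℂ M) {κ : Type*} (c : HilbertBasis κ ℂ H₂)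
    -- the quaternion side
    (τ₂ : ContRepresentation ℂ Γ₂ H₂) (hτ₂ : τ₂.IsUnitary) (ι₂ : 𝔊₂ →* Γ₂)
    (hc₂ : (τ₂.restrict ι₂).IsStronglyContinuous)
    (Kset₂ : Set Γ₂) (hgen₂ : ∀ γ : Γ₂, ∃ k ∈ Kset₂, ∃ g : 𝔊₂, γ = k * ι₂ g)
    (E₂ : H₂ →L[ℂ] H₂) (hE₂sa : ∀ u v : H₂, ⟪E₂ u, v⟫_ℂ = ⟪u, E₂ v⟫_ℂ)
    (hE₂idem : ∀ v, E₂ (E₂ v) = E₂ v)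
    (hE₂T : ∀ U : H₂ →L[ℂ] H₂, (∀ γ : Γ₂, U ∘L τ₂ γ = τ₂ γ ∘L U) → U ∘L E₂ = E₂ ∘L U)
    (hE₂ι : ∀ g : 𝔊₂, E₂ ∘L τ₂ (ι₂ g) = τ₂ (ι₂ g) ∘L E₂) (c₂ : Γ₂ → ℂ)
    (hE₂K : ∀ k ∈ Kset₂, ∀ y, E₂ y = y → E₂ (τ₂ k y) = c₂ k • y)
    -- the matched family of test functions
    (𝒜 : Submodule ℂ (C_c(𝔊₁, ℂ) × C_c(𝔊₂, ℂ)))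
    (h𝒜conv : ∀ a ∈ 𝒜, ∀ a' ∈ 𝒜, ∃ d ∈ 𝒜, (∀ x, d.1 x = mulConv η₁ (⇑a.1) (⇑a'.1) x) ∧
      (∀ x, d.2 x = mulConv η₂ (⇑a.2) (⇑a'.2) x))
    (h𝒜star : ∀ a ∈ 𝒜, ∃ d ∈ 𝒜, (∀ x, d.1 x = mulStar (⇑a.1) x) ∧ (∀ x, d.2 x = mulStar (⇑a.2) x))
    (h𝒜δ₁ : ∀ (g : 𝔊₁) (U : Set 𝔊₁), U ∈ 𝓝 g → ∃ a ∈ 𝒜, (∀ x, 0 ≤ (a.1 x).re ∧ (a.1 x).im = 0) ∧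
      tsupport a.1 ⊆ U ∧ ∫ x, (a.1 x).re ∂η₁ = 1)
    (h𝒜δ₂ : ∀ (g : 𝔊₂) (U : Set 𝔊₂), U ∈ 𝓝 g → ∃ a ∈ 𝒜, (∀ x, 0 ≤ (a.2 x).re ∧ (a.2 x).im = 0) ∧
      tsupport a.2 ⊆ U ∧ ∫ x, (a.2 x).re ∂η₂ = 1)
    (hHS : ∀ a ∈ 𝒜,
      ∑' j, (‖E₂ ((τ₂.restrict ι₂).integratedOperator (hτ₂.restrict ι₂) hc₂ η₂ a.2 (c j))‖₊ :
          ℝ≥0∞) ^ 2 ≤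
        ∑' i, (‖E₁ ((τ₁.restrict ι₁).integratedOperator (hτ₁.restrict ι₁) hc₁ η₁ a.1 (b i))‖₊ :
          ℝ≥0∞) ^ 2)
    (hfin : ∀ a ∈ 𝒜,
      ∑' i, (‖E₁ ((τ₁.restrict ι₁).integratedOperator (hτ₁.restrict ι₁) hc₁ η₁ a.1 (b i))‖₊ :
        ℝ≥0∞) ^ 2 < ∞)
    -- the two constituents
    (W₁ W₂ : ClosedSubrep τ₂) (hW₁ : W₁.toContRep.IsTopIrreducible)
    (hW₂ : W₂.toContRep.IsTopIrreducible) (hW : AreUnitarilyEquivalent W₁.toContRep W₂.toContRep)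
    (hx : ∃ x ∈ W₁, x ≠ 0 ∧ E₂ x = x) :
    ¬ W₁.toSubmodule ⟂ W₂.toSubmodule := by
  -- the integrated operators of the complementary groups
  set R₁ : C_c(𝔊₁, ℂ) → (H₁ →L[ℂ] H₁) := fun F =>
    (τ₁.restrict ι₁).integratedOperator (hτ₁.restrict ι₁) hc₁ η₁ F with hR₁
  set R₂ : C_c(𝔊₂, ℂ) → (H₂ →L[ℂ] H₂) := fun F =>
    (τ₂.restrict ι₂).integratedOperator (hτ₂.restrict ι₂) hc₂ η₂ F with hR₂
  have hrestr₁ : ∀ g : 𝔊₁, (τ₁.restrict ι₁) g = τ₁ (ι₁ g) := fun g => rfl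
  have hrestr₂ : ∀ g : 𝔊₂, (τ₂.restrict ι₂) g = τ₂ (ι₂ g) := fun g => rfl
  -- `Eᵢ` commutes with the `Rᵢ F`
  have hER₁ : ∀ F, E₁ ∘L R₁ F = R₁ F ∘L E₁ := fun F =>
    comp_integratedOperator_eq_integratedOperator_comp _ _ _ η₁ F E₁ fun g => hE₁ι g
  have hER₂ : ∀ F, E₂ ∘L R₂ F = R₂ F ∘L E₂ := fun F =>
    comp_integratedOperator_eq_integratedOperator_comp _ _ _ η₂ F E₂ fun g => hE₂ι g
  have hE₁E₁ : E₁ ∘L E₁ = E₁ := ContinuousLinearMap.ext fun v => hE₁idem v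
  have hE₂E₂ : E₂ ∘L E₂ = E₂ := ContinuousLinearMap.ext fun v => hE₂idem v
  have hE₁adj : ContinuousLinearMap.adjoint E₁ = E₁ :=
    ((ContinuousLinearMap.eq_adjoint_iff _ _).mpr fun x y => hE₁sa x y).symm
  have hE₂adj : ContinuousLinearMap.adjoint E₂ = E₂ :=
    ((ContinuousLinearMap.eq_adjoint_iff _ _).mpr fun x y => hE₂sa x y).symm
  -- the linear map `(F₁, F₂) ↦ (E₁ τ₁(F₁), E₂ τ₂(F₂))` and the family `B`
  let Ψ : (C_c(𝔊₁, ℂ) × C_c(𝔊₂, ℂ)) →ₗ[ℂ] ((H₁ →L[ℂ] H₁) × (H₂ →L[ℂ] H₂)) :=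
    { toFun := fun a => (E₁ ∘L R₁ a.1, E₂ ∘L R₂ a.2)
      map_add' := fun a a' => by
        ext1
        · change E₁ ∘L R₁ (a.1 + a'.1) = E₁ ∘L R₁ a.1 + E₁ ∘L R₁ a'.1
          rw [hR₁]
          dsimp only
          rw [integratedOperator_add, ContinuousLinearMap.comp_add]
        · change E₂ ∘L R₂ (a.2 + a'.2) = E₂ ∘L R₂ a.2 + E₂ ∘L R₂ a'.2
          rw [hR₂]
          dsimp only
          rw [integratedOperator_add, ContinuousLinearMap.comp_add]
      map_smul' := fun z a => by
        ext1
        · change E₁ ∘L R₁ (z • a.1) = z • (E₁ ∘L R₁ a.1)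
          rw [hR₁]
          dsimp only
          rw [integratedOperator_smul, ContinuousLinearMap.comp_smul]
        · change E₂ ∘L R₂ (z • a.2) = z • (E₂ ∘L R₂ a.2)
          rw [hR₂]
          dsimp only
          rw [integratedOperator_smul, ContinuousLinearMap.comp_smul] }
  have hΨ : ∀ a, Ψ a = (E₁ ∘L R₁ a.1, E₂ ∘L R₂ a.2) := fun a => rfl
  set B : Submodule ℂ ((H₁ →L[ℂ] H₁) × (H₂ →L[ℂ] H₂)) := 𝒜.map Ψ with hBdef
  have hmemB : ∀ {f}, f ∈ B ↔ ∃ a ∈ 𝒜, Ψ a = f := fun {f} => Submodule.mem_map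
  -- closure under products
  have hmul : ∀ f ∈ B, ∀ h ∈ B, f * h ∈ B := by
    intro f hf h hh
    obtain ⟨a, ha, rfl⟩ := hmemB.1 hf
    obtain ⟨a', ha', rfl⟩ := hmemB.1 hh
    obtain ⟨d, hd, hd1, hd2⟩ := h𝒜conv a ha a' ha'
    refine hmemB.2 ⟨d, hd, ?_⟩
    rw [hΨ, hΨ, hΨ, Prod.mk_mul_mk]
    ext1
    · change E₁ ∘L R₁ d.1 = (E₁ ∘L R₁ a.1) ∘L (E₁ ∘L R₁ a'.1)
      rw [ContinuousLinearMap.comp_assoc, ← ContinuousLinearMap.comp_assoc (R₁ a.1), ← hER₁,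
        ContinuousLinearMap.comp_assoc, ← ContinuousLinearMap.comp_assoc E₁ E₁, hE₁E₁]
      congr 1
      exact (integratedOperator_comp_integratedOperator _ _ η₁ a.1 a'.1 d.1 hd1).symm
    · change E₂ ∘L R₂ d.2 = (E₂ ∘L R₂ a.2) ∘L (E₂ ∘L R₂ a'.2)
      rw [ContinuousLinearMap.comp_assoc, ← ContinuousLinearMap.comp_assoc (R₂ a.2), ← hER₂,
        ContinuousLinearMap.comp_assoc, ← ContinuousLinearMap.comp_assoc E₂ E₂, hE₂E₂]
      congr 1
      exact (integratedOperator_comp_integratedOperator _ _ η₂ a.2 a'.2 d.2 hd2).symm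
  -- closure under adjoints
  have hstar : ∀ f ∈ B, star f ∈ B := by
    intro f hf
    obtain ⟨a, ha, rfl⟩ := hmemB.1 hf
    obtain ⟨d, hd, hd1, hd2⟩ := h𝒜star a ha
    refine hmemB.2 ⟨d, hd, ?_⟩
    rw [hΨ, hΨ]
    ext1
    · change E₁ ∘L R₁ d.1 = star (E₁ ∘L R₁ a.1)
      rw [ContinuousLinearMap.star_eq_adjoint, ContinuousLinearMap.adjoint_comp, hE₁adj,
        adjoint_integratedOperator _ _ η₁ a.1 d.1 hd1, ← hER₁]
    · change E₂ ∘L R₂ d.2 = star (E₂ ∘L R₂ a.2)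
      rw [ContinuousLinearMap.star_eq_adjoint, ContinuousLinearMap.adjoint_comp, hE₂adj,
        adjoint_integratedOperator _ _ η₂ a.2 d.2 hd2, ← hER₂]
  -- `M` is closed and stable under the first components
  have hMc : IsClosed (M : Set H₁) := by
    have : (M : Set H₁) = (L : Set H₁) ∩ {y | E₁ y = y} := Set.ext fun y => hM y
    rw [this]
    exact L.isClosed.inter (isClosed_eq E₁.continuous continuous_id)
  have hML : M ≤ L.toSubmodule := fun y hy => ((hM y).1 hy).1
  have hME : ∀ y ∈ M, E₁ y = y := fun y hy => ((hM y).1 hy).2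
  let L' : ClosedSubrep (τ₁.restrict ι₁) :=
    { toSubmodule := L.toSubmodule
      apply_mem_toSubmodule := fun g v hv => L.apply_mem (ι₁ g) hv
      isClosed' := L.isClosed }
  have hR₁L : ∀ F, ∀ y ∈ L, R₁ F y ∈ L := fun F y hy =>
    integratedOperator_apply_mem (hτ₁.restrict ι₁) hc₁ η₁ F L' hy
  have hMB : ∀ f ∈ B, ∀ x ∈ M, f.1 x ∈ M := by
    intro f hf x hx
    obtain ⟨a, ha, rfl⟩ := hmemB.1 hf
    rw [hΨ]
    change E₁ (R₁ a.1 x) ∈ M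
    exact (hM _).2 ⟨ClosedSubrep.apply_mem_of_forall_comp_eq hτ₁ hE₁T L (hR₁L a.1 x (hML hx)),
      hE₁idem _⟩
  -- first and second components commute with the commutants
  have hB₁T : ∀ f ∈ B, ∀ U : H₁ →L[ℂ] H₁, (∀ γ : Γ₁, U ∘L τ₁ γ = τ₁ γ ∘L U) →
      U ∘L f.1 = f.1 ∘L U := by
    intro f hf U hU
    obtain ⟨a, ha, rfl⟩ := hmemB.1 hf
    rw [hΨ]
    change U ∘L (E₁ ∘L R₁ a.1) = (E₁ ∘L R₁ a.1) ∘L U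
    rw [← ContinuousLinearMap.comp_assoc, hE₁T U hU, ContinuousLinearMap.comp_assoc,
      comp_integratedOperator_eq_integratedOperator_comp _ _ _ η₁ a.1 U (fun g => hU (ι₁ g)),
      ContinuousLinearMap.comp_assoc]
  have hB₂T : ∀ f ∈ B, ∀ U : H₂ →L[ℂ] H₂, (∀ γ : Γ₂, U ∘L τ₂ γ = τ₂ γ ∘L U) →
      U ∘L f.2 = f.2 ∘L U := by
    intro f hf U hU
    obtain ⟨a, ha, rfl⟩ := hmemB.1 hf
    rw [hΨ]
    change U ∘L (E₂ ∘L R₂ a.2) = (E₂ ∘L R₂ a.2) ∘L U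
    rw [← ContinuousLinearMap.comp_assoc, hE₂T U hU, ContinuousLinearMap.comp_assoc,
      comp_integratedOperator_eq_integratedOperator_comp _ _ _ η₂ a.2 U (fun g => hU (ι₂ g)),
      ContinuousLinearMap.comp_assoc]
  have hB₁E : ∀ f ∈ B, ∀ y, E₁ y = y → E₁ (f.1 y) = f.1 y := by
    intro f hf y _
    obtain ⟨a, ha, rfl⟩ := hmemB.1 hf
    exact hE₁idem _
  have hB₂E : ∀ f ∈ B, ∀ y, E₂ (f.2 y) = f.2 y := by
    intro f hf y
    obtain ⟨a, ha, rfl⟩ := hmemB.1 hf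
    exact hE₂idem _
  have hB₂E' : ∀ f ∈ B, ∀ y, f.2 (E₂ y) = f.2 y := by
    intro f hf y
    obtain ⟨a, ha, rfl⟩ := hmemB.1 hf
    rw [hΨ]
    change (E₂ ∘L R₂ a.2) (E₂ y) = (E₂ ∘L R₂ a.2) y
    rw [hER₂, ContinuousLinearMap.comp_apply, ContinuousLinearMap.comp_apply, hE₂idem]
  -- approximation of `τᵢ(ιᵢ g₀)` by the components of `B`
  have hApprox₁ : ∀ γ ∈ Set.range ι₁, ∀ y ∈ M, ∀ y' ∈ M, ∀ ε > (0 : ℝ), ∃ f ∈ B,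
      ‖f.1 y - τ₁ γ y‖ < ε ∧ ‖f.1 y' - τ₁ γ y'‖ < ε := by
    rintro _ ⟨g₀, rfl⟩ y hy y' hy' ε hε
    set U : Set 𝔊₁ := {g | ‖τ₁ (ι₁ g) y - τ₁ (ι₁ g₀) y‖ < ε / 2 ∧
      ‖τ₁ (ι₁ g) y' - τ₁ (ι₁ g₀) y'‖ < ε / 2} with hUdef
    have hUo : IsOpen U := by
      refine IsOpen.inter ?_ ?_
      · exact isOpen_lt (((hc₁ y).sub continuous_const).norm) continuous_const
      · exact isOpen_lt (((hc₁ y').sub continuous_const).norm) continuous_const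
    have hg₀U : g₀ ∈ U := by
      constructor <;> simp [half_pos hε]
    obtain ⟨a, ha, hre, hsupp, h1⟩ := h𝒜δ₁ g₀ U (hUo.mem_nhds hg₀U)
    refine ⟨Ψ a, hmemB.2 ⟨a, ha, rfl⟩, ?_, ?_⟩
    · rw [hΨ]
      change ‖(E₁ ∘L R₁ a.1) y - τ₁ (ι₁ g₀) y‖ < ε
      rw [hER₁, ContinuousLinearMap.comp_apply, hME y hy]
      refine lt_of_le_of_lt (norm_integratedOperator_apply_sub_le_of_integral_eq_one _ hc₁ η₁ a.1
        hre h1 y g₀ fun g hg => (le_of_lt (hsupp hg).1)) (half_lt_self hε)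
    · rw [hΨ]
      change ‖(E₁ ∘L R₁ a.1) y' - τ₁ (ι₁ g₀) y'‖ < ε
      rw [hER₁, ContinuousLinearMap.comp_apply, hME y' hy']
      refine lt_of_le_of_lt (norm_integratedOperator_apply_sub_le_of_integral_eq_one _ hc₁ η₁ a.1
        hre h1 y' g₀ fun g hg => (le_of_lt (hsupp hg).2)) (half_lt_self hε)
  have hApprox₂ : ∀ γ ∈ Set.range ι₂, ∀ y : H₂, E₂ y = y → ∀ ε > (0 : ℝ), ∃ f ∈ B,
      ‖f.2 y - τ₂ γ y‖ < ε := by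
    rintro _ ⟨g₀, rfl⟩ y hy ε hε
    set U : Set 𝔊₂ := {g | ‖τ₂ (ι₂ g) y - τ₂ (ι₂ g₀) y‖ < ε / 2} with hUdef
    have hUo : IsOpen U := isOpen_lt (((hc₂ y).sub continuous_const).norm) continuous_const
    have hg₀U : g₀ ∈ U := by simp [hUdef, half_pos hε]
    obtain ⟨a, ha, hre, hsupp, h1⟩ := h𝒜δ₂ g₀ U (hUo.mem_nhds hg₀U)
    refine ⟨Ψ a, hmemB.2 ⟨a, ha, rfl⟩, ?_⟩
    rw [hΨ]
    change ‖(E₂ ∘L R₂ a.2) y - τ₂ (ι₂ g₀) y‖ < ε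
    rw [hER₂, ContinuousLinearMap.comp_apply, hy]
    exact lt_of_le_of_lt (norm_integratedOperator_apply_sub_le_of_integral_eq_one _ hc₂ η₂ a.2
      hre h1 y g₀ fun g hg => (le_of_lt (hsupp hg))) (half_lt_self hε)
  -- the Hilbert–Schmidt inequality along `B`
  have hHS' : ∀ f ∈ B, ∑' j, (‖f.2 (c j)‖₊ : ℝ≥0∞) ^ 2 ≤ ∑' i, (‖f.1 (b i)‖₊ : ℝ≥0∞) ^ 2 := by
    intro f hf
    obtain ⟨a, ha, rfl⟩ := hmemB.1 hf
    exact hHS a ha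
  have hfin' : ∀ f ∈ B, ∑' i, (‖f.1 (b i)‖₊ : ℝ≥0∞) ^ 2 < ∞ := by
    intro f hf
    obtain ⟨a, ha, rfl⟩ := hmemB.1 hf
    exact hfin a ha
  -- non-degeneracy on `W₁`
  have hnd : ∃ f ∈ B, ∃ x ∈ W₁, f.2 x ≠ 0 := by
    obtain ⟨x, hxW, hx0, hEx⟩ := hx
    have hxpos : 0 < ‖x‖ := norm_pos_iff.mpr hx0
    set U : Set 𝔊₂ := {g | ‖τ₂ (ι₂ g) x - τ₂ (ι₂ 1) x‖ < ‖x‖ / 2} with hUdef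
    have hUo : IsOpen U := isOpen_lt (((hc₂ x).sub continuous_const).norm) continuous_const
    have h1U : (1 : 𝔊₂) ∈ U := by simp [hUdef, half_pos hxpos]
    obtain ⟨a, ha, hre, hsupp, h1⟩ := h𝒜δ₂ 1 U (hUo.mem_nhds h1U)
    refine ⟨Ψ a, hmemB.2 ⟨a, ha, rfl⟩, x, hxW, fun h0 => ?_⟩
    have hest := norm_integratedOperator_apply_sub_le_of_integral_eq_one (hτ₂.restrict ι₂) hc₂ η₂
      a.2 hre h1 x 1 fun g hg => (le_of_lt (hsupp hg))
    rw [hΨ] at h0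
    change (E₂ ∘L R₂ a.2) x = 0 at h0
    rw [hER₂, ContinuousLinearMap.comp_apply, hEx] at h0
    change (τ₂.restrict ι₂).integratedOperator (hτ₂.restrict ι₂) hc₂ η₂ a.2 x = 0 at h0
    rw [h0, map_one, zero_sub, norm_neg] at hest
    change ‖x‖ ≤ ‖x‖ / 2 at hest
    linarith
  -- assemble
  exact not_isOrtho_of_sliceComparison (𝔳 := PEmpty.{1}) (G := fun _ => PUnit.{1})
    (fun v => v.elim) (fun v => v.elim) (fun v => v.elim) (fun v => v.elim) B hmul hstar
    (fun v => v.elim) M hMc (fun v => v.elim) hMB b c hHS' hfin' τ₁ hτ₁ L hMO hatom Kset₁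
    (Set.range ι₁) (fun γ => by
      obtain ⟨k, hk, g, rfl⟩ := hgen₁ γ
      exact ⟨k, hk, ι₁ g, ⟨g, rfl⟩, rfl⟩)
    (fun v => v.elim) E₁ hE₁sa hE₁idem hE₁T
    (by rintro _ ⟨g, rfl⟩ y; exact (DFunLike.congr_fun (hE₁ι g) y :))
    c₁ hE₁K hML hME hB₁T hB₁E hApprox₁ τ₂ hτ₂ Kset₂ (Set.range ι₂)
    (fun γ => by
      obtain ⟨k, hk, g, rfl⟩ := hgen₂ γ
      exact ⟨k, hk, ι₂ g, ⟨g, rfl⟩, rfl⟩)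
    (fun v => v.elim) E₂ hE₂idem hE₂T
    (by rintro _ ⟨g, rfl⟩ y; exact (DFunLike.congr_fun (hE₂ι g) y :))
    c₂ hE₂K hB₂T hB₂E hB₂E' hApprox₂ W₁ W₂ hW₁ hW₂ hW hnd

end TestFamily

end Literature.NumberTheory.Automorphic

/-! ### Multiplicity one for `D^×` from a matched family of test functions -/

namespace Literature.NumberTheory.Automorphic

open _root_.MeasureTheory NumberField ContRepresentation

universe u

section Assembly

variable (K : Type) [Field K] [NumberField K] (D : Type u) [Ring D] [Algebra K D]
  [IsQuaternionAlgebra K D]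
  {𝔊₁ : Type*} [Group 𝔊₁] [TopologicalSpace 𝔊₁] [IsTopologicalGroup 𝔊₁] [MeasurableSpace 𝔊₁]
  [BorelSpace 𝔊₁] [SecondCountableTopology 𝔊₁]
  {𝔊₂ : Type*} [Group 𝔊₂] [TopologicalSpace 𝔊₂] [IsTopologicalGroup 𝔊₂] [MeasurableSpace 𝔊₂]
  [BorelSpace 𝔊₂] [SecondCountableTopology 𝔊₂]

/-- **`L²_cusp(GL_n)` has multiplicity one below it, in the lattice of closed invariant subspaces
of `L²`**, given the named fact `multiplicity_one_gl n K μ` (transport along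
`ClosedSubrep.restrictLE` / `inflate`). [cite: Gelbart1975, Thm. 5.7] -/
theorem eq_of_le_cuspidalSubspace_of_areUnitarilyEquivalent (n : ℕ)
    (μ : Measure (AdelicGroupData.gl n K).automorphicQuotient)
    [(AdelicGroupData.gl n K).IsAutomorphicMeasure μ] (hMO : multiplicity_one_gl n K μ)
    (N N' : ClosedSubrep ((AdelicGroupData.gl n K).rightRegular μ))
    (hN : N ≤ cuspidalSubspace n K μ) (hN' : N' ≤ cuspidalSubspace n K μ)
    (hNirr : N.toContRep.IsTopIrreducible) (hN'irr : N'.toContRep.IsTopIrreducible)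
    (hNN' : AreUnitarilyEquivalent N.toContRep N'.toContRep) : N = N' := by
  set L := cuspidalSubspace n K μ
  have hMO1 : L.toContRep.HasMultiplicityOne := hMO
  have e1 := ClosedSubrep.areUnitarilyEquivalent_restrictLE L hN
  have e2 := ClosedSubrep.areUnitarilyEquivalent_restrictLE L hN'
  have hirr1 : (L.restrictLE N).toContRep.IsTopIrreducible := by
    obtain ⟨e, -⟩ := e1
    exact (isTopIrreducible_congr e).2 hNirr
  have hirr2 : (L.restrictLE N').toContRep.IsTopIrreducible := by
    obtain ⟨e, -⟩ := e2
    exact (isTopIrreducible_congr e).2 hN'irr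
  have hEq : L.restrictLE N = L.restrictLE N' :=
    hMO1 _ _ hirr1 hirr2 (e1.trans (hNN'.trans e2.symm))
  rw [← ClosedSubrep.inflate_restrictLE L hN, ← ClosedSubrep.inflate_restrictLE L hN', hEq]

/-- **Every non-zero closed invariant subspace of `L²_cusp(GL_n)` contains an irreducible one**
(atomicity below `L²_cusp`, from the proved discreteness
`AutomorphicGLn.isDiscretelyDecomposable_cuspidal_holds` through
`IsUnitary.exists_isTopIrreducible_le_of_isDiscretelyDecomposable`).
[cite: GelfandGraevPiatetskiShapiro1969, Ch. 3] -/
theorem exists_isTopIrreducible_le_of_le_cuspidalSubspace (n : ℕ)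
    (μ : Measure (AdelicGroupData.gl n K).automorphicQuotient)
    [(AdelicGroupData.gl n K).IsAutomorphicMeasure μ]
    (U : ClosedSubrep ((AdelicGroupData.gl n K).rightRegular μ)) (hU : U ≤ cuspidalSubspace n K μ)
    (hU0 : U ≠ ⊥) :
    ∃ N : ClosedSubrep ((AdelicGroupData.gl n K).rightRegular μ),
      N ≤ U ∧ N.toContRep.IsTopIrreducible := by
  set L := cuspidalSubspace n K μ
  have hτ : ((AdelicGroupData.gl n K).rightRegular μ).IsUnitary :=
    (AdelicGroupData.gl n K).isUnitary_rightRegular μ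
  have hd : L.toContRep.IsDiscretelyDecomposable :=
    AutomorphicGLn.isDiscretelyDecomposable_cuspidal_holds n K μ
  have hU0' : L.restrictLE U ≠ ⊥ := fun h0 =>
    hU0 (by rw [← ClosedSubrep.inflate_restrictLE L hU, h0, ClosedSubrep.inflate_bot])
  obtain ⟨W₀, hW₀irr, hW₀le⟩ :=
    (hτ.toContRep L).exists_isTopIrreducible_le_of_isDiscretelyDecomposable hd hU0'
  refine ⟨L.inflate W₀, ?_, (ClosedSubrep.isTopIrreducible_inflate_iff L W₀).2 hW₀irr⟩
  calc L.inflate W₀ ≤ L.inflate (L.restrictLE U) := (ClosedSubrep.inflate_le_inflate_iff L).2 hW₀le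
    _ = U := ClosedSubrep.inflate_restrictLE L hU

/-- **Multiplicity one for `D^×` from a matched family of test functions (Gelbart's Thm. 10.10,
with the operator theory of the proof of Thm. 10.5 carried out).** Fix locally compact second
countable groups `𝔊₁`, `𝔊₂` with left- and inversion-invariant measures finite on compacts and
continuous homomorphisms `ι₁ : 𝔊₁ → GL₂(𝔸_K)`, `ι₂ : 𝔊₂ → D_𝔸ˣ` (the complementary groups
`G_S ≅ G'_S`, `S ⊇ Ram(D)`, p. 152), and subsets `K₁ ⊆ GL₂(𝔸_K)`, `K₂ ⊆ D_𝔸ˣ` with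
`GL₂(𝔸_K) = K₁ · ι₁(𝔊₁)`, `D_𝔸ˣ = K₂ · ι₂(𝔊₂)` (the ramified components). Assume multiplicity one
for `GL₂` (`multiplicity_one_gl 2 K μ`, Gelbart Thm. 5.7) and, for `D` division, every automorphic
`μ_D` and every pair `W₁ ≅ W₂` of equivalent irreducible closed invariant subspaces of
`L²(D_𝔸ˣ ⧸ ℝ_{>0} Dˣ)` of dimension `≠ 1`, the following output of the proof of Thm. 10.5 for the
type of `W₁`: an automorphic measure `μ` on the `GL₂` side; self-adjoint idempotents `E₁` on
`L²(GL₂)` and `E₂` on `L²(D_𝔸ˣ ⧸ ℝ_{>0} Dˣ)` commuting with the commutants of the regular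
representations and with the complementary groups, acting by `Eᵢ R(k) y = cᵢ(k) y` on `Eᵢ`-fixed
vectors for `k ∈ Kᵢ` (the `R(ξ_S)`, `R'(ξ'_S)` of pp. 151–153, orthogonality relations (10.11) —
in the tree `ContRepresentation.exists_minimalIdempotent_spec` for any irreducible unitary local
types), with `W₁` containing a non-zero `E₂`-fixed vector (the type of `π'` at `S`); Gelbart's
`M = {y ∈ L²_cusp : E₁ y = y}` with a Hilbert basis `(b_i)`, a Hilbert basis `(c_j)` of
`L²(D_𝔸ˣ ⧸ ℝ_{>0} Dˣ)`; and a `ℂ`-subspace `𝒜` of matched test-function pairs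
`(F₁, F₂) ∈ C_c(𝔊₁) × C_c(𝔊₂)` closed under convolution and involution, with approximate
identities on both sides, along which **`Σ_j ‖E₂ R'(F₂) c_j‖² ≤ Σ_i ‖E₁ R(F₁) b_i‖² < ∞`** — the
trace identity (10.10) `tr τ'(F * F^*) = tr τ(F * F^*)` in Hilbert–Schmidt form, as an
inequality, i.e. (10.12)–(10.15) with the comparison (10.16)–(10.22). **Then
`multiplicity_one_quaternionUnits K D`.** (`not_isOrtho_of_testFamily` and
`multiplicity_one_quaternionUnits_of_forall_not_isOrtho`.) What remains under the named fact
after this: the choice of local types with a copy in `π'` (Peter–Weyl for `G'_S`), the matched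
test functions, and the trace-formula inequality on them — Gelbart (10.14)–(10.22).
[cite: Gelbart1975, Thm. 10.10 (proof), p. 158; Gelbart1975, Thm. 10.5 (proof), pp. 151–155] -/
theorem multiplicity_one_quaternionUnits_of_testFamily
    (η₁ : Measure 𝔊₁) [IsFiniteMeasureOnCompacts η₁] [SFinite η₁] [η₁.IsMulLeftInvariant]
    [η₁.IsInvInvariant]
    (η₂ : Measure 𝔊₂) [IsFiniteMeasureOnCompacts η₂] [SFinite η₂] [η₂.IsMulLeftInvariant]
    [η₂.IsInvInvariant]
    (ι₁ : 𝔊₁ →* (AdelicGroupData.gl 2 K).Adelic) (hι₁ : Continuous ι₁)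
    (ι₂ : 𝔊₂ →* (AdelicGroupData.units K D).Adelic) (hι₂ : Continuous ι₂)
    (Kset₁ : Set (AdelicGroupData.gl 2 K).Adelic)
    (hgen₁ : ∀ γ, ∃ k ∈ Kset₁, ∃ g : 𝔊₁, γ = k * ι₁ g)
    (Kset₂ : Set (AdelicGroupData.units K D).Adelic)
    (hgen₂ : ∀ γ, ∃ k ∈ Kset₂, ∃ g : 𝔊₂, γ = k * ι₂ g)
    (hMO : ∀ (μ : Measure (AdelicGroupData.gl 2 K).automorphicQuotient)
      [(AdelicGroupData.gl 2 K).IsAutomorphicMeasure μ], multiplicity_one_gl 2 K μ)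
    (h : ∀ (_hdiv : ∀ x : D, x ≠ 0 → IsUnit x)
      (μ_D : Measure (AdelicGroupData.units K D).automorphicQuotient)
      [(AdelicGroupData.units K D).IsAutomorphicMeasure μ_D]
      (W₁ W₂ : ClosedSubrep ((AdelicGroupData.units K D).rightRegular μ_D)),
      W₁.toContRep.IsTopIrreducible → W₂.toContRep.IsTopIrreducible →
      Module.finrank ℂ W₁.toSubmodule ≠ 1 → Module.finrank ℂ W₂.toSubmodule ≠ 1 →
      AreUnitarilyEquivalent W₁.toContRep W₂.toContRep →
      ∃ (μ : Measure (AdelicGroupData.gl 2 K).automorphicQuotient)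
        (_ : (AdelicGroupData.gl 2 K).IsAutomorphicMeasure μ)
        (E₁ : (AdelicGroupData.gl 2 K).L2 μ →L[ℂ] (AdelicGroupData.gl 2 K).L2 μ)
        (c₁ : (AdelicGroupData.gl 2 K).Adelic → ℂ)
        (M : Submodule ℂ ((AdelicGroupData.gl 2 K).L2 μ))
        (ι : Type) (b : HilbertBasis ι ℂ M) (κ : Type u)
        (c : HilbertBasis κ ℂ ((AdelicGroupData.units K D).L2 μ_D))
        (E₂ : (AdelicGroupData.units K D).L2 μ_D →L[ℂ] (AdelicGroupData.units K D).L2 μ_D)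
        (c₂ : (AdelicGroupData.units K D).Adelic → ℂ)
        (𝒜 : Submodule ℂ (C_c(𝔊₁, ℂ) × C_c(𝔊₂, ℂ))),
        -- `E₁`, `M`
        (∀ u v, ⟪E₁ u, v⟫_ℂ = ⟪u, E₁ v⟫_ℂ) ∧ (∀ v, E₁ (E₁ v) = E₁ v) ∧
        (∀ U : (AdelicGroupData.gl 2 K).L2 μ →L[ℂ] (AdelicGroupData.gl 2 K).L2 μ,
          (∀ γ, U ∘L (AdelicGroupData.gl 2 K).rightRegular μ γ =
            (AdelicGroupData.gl 2 K).rightRegular μ γ ∘L U) → U ∘L E₁ = E₁ ∘L U) ∧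
        (∀ g : 𝔊₁, E₁ ∘L (AdelicGroupData.gl 2 K).rightRegular μ (ι₁ g) =
          (AdelicGroupData.gl 2 K).rightRegular μ (ι₁ g) ∘L E₁) ∧
        (∀ k ∈ Kset₁, ∀ y, E₁ y = y →
          E₁ ((AdelicGroupData.gl 2 K).rightRegular μ k y) = c₁ k • y) ∧
        (∀ y, y ∈ M ↔ y ∈ cuspidalSubspace 2 K μ ∧ E₁ y = y) ∧
        -- `E₂`
        (∀ u v, ⟪E₂ u, v⟫_ℂ = ⟪u, E₂ v⟫_ℂ) ∧ (∀ v, E₂ (E₂ v) = E₂ v) ∧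
        (∀ U : (AdelicGroupData.units K D).L2 μ_D →L[ℂ] (AdelicGroupData.units K D).L2 μ_D,
          (∀ γ, U ∘L (AdelicGroupData.units K D).rightRegular μ_D γ =
            (AdelicGroupData.units K D).rightRegular μ_D γ ∘L U) → U ∘L E₂ = E₂ ∘L U) ∧
        (∀ g : 𝔊₂, E₂ ∘L (AdelicGroupData.units K D).rightRegular μ_D (ι₂ g) =
          (AdelicGroupData.units K D).rightRegular μ_D (ι₂ g) ∘L E₂) ∧
        (∀ k ∈ Kset₂, ∀ y, E₂ y = y →
          E₂ ((AdelicGroupData.units K D).rightRegular μ_D k y) = c₂ k • y) ∧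
        (∃ x ∈ W₁, x ≠ 0 ∧ E₂ x = x) ∧
        -- the matched test functions
        (∀ a ∈ 𝒜, ∀ a' ∈ 𝒜, ∃ d ∈ 𝒜, (∀ x, d.1 x = mulConv η₁ (⇑a.1) (⇑a'.1) x) ∧
          (∀ x, d.2 x = mulConv η₂ (⇑a.2) (⇑a'.2) x)) ∧
        (∀ a ∈ 𝒜, ∃ d ∈ 𝒜, (∀ x, d.1 x = mulStar (⇑a.1) x) ∧ (∀ x, d.2 x = mulStar (⇑a.2) x)) ∧
        (∀ (g : 𝔊₁) (U : Set 𝔊₁), U ∈ 𝓝 g → ∃ a ∈ 𝒜, (∀ x, 0 ≤ (a.1 x).re ∧ (a.1 x).im = 0) ∧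
          tsupport a.1 ⊆ U ∧ ∫ x, (a.1 x).re ∂η₁ = 1) ∧
        (∀ (g : 𝔊₂) (U : Set 𝔊₂), U ∈ 𝓝 g → ∃ a ∈ 𝒜, (∀ x, 0 ≤ (a.2 x).re ∧ (a.2 x).im = 0) ∧
          tsupport a.2 ⊆ U ∧ ∫ x, (a.2 x).re ∂η₂ = 1) ∧
        -- the trace inequality (10.10)
        (∀ a ∈ 𝒜,
          ∑' j, (‖E₂ ((((AdelicGroupData.units K D).rightRegular μ_D).restrict ι₂).integratedOperator
              (((AdelicGroupData.units K D).isUnitary_rightRegular μ_D).restrict ι₂)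
              (((AdelicGroupData.units K D).isStronglyContinuous_rightRegular_holds μ_D).restrict
                ι₂ hι₂) η₂ a.2 (c j))‖₊ : ℝ≥0∞) ^ 2 ≤
            ∑' i, (‖E₁ ((((AdelicGroupData.gl 2 K).rightRegular μ).restrict ι₁).integratedOperator
              (((AdelicGroupData.gl 2 K).isUnitary_rightRegular μ).restrict ι₁)
              (((AdelicGroupData.gl 2 K).isStronglyContinuous_rightRegular_holds μ).restrict
                ι₁ hι₁) η₁ a.1 (b i))‖₊ : ℝ≥0∞) ^ 2 ∧
          ∑' i, (‖E₁ ((((AdelicGroupData.gl 2 K).rightRegular μ).restrict ι₁).integratedOperator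
              (((AdelicGroupData.gl 2 K).isUnitary_rightRegular μ).restrict ι₁)
              (((AdelicGroupData.gl 2 K).isStronglyContinuous_rightRegular_holds μ).restrict
                ι₁ hι₁) η₁ a.1 (b i))‖₊ : ℝ≥0∞) ^ 2 < ∞)) :
    multiplicity_one_quaternionUnits K D := by
  refine multiplicity_one_quaternionUnits_of_forall_not_isOrtho K D
    fun hdiv μ_D _ W₁ W₂ hW₁ hW₂ h1 h1' he => ?_
  obtain ⟨μ, hμ, E₁, c₁, M, ι, b, κ, c, E₂, c₂, 𝒜, hE₁sa, hE₁idem, hE₁T, hE₁ι, hE₁K, hM, hE₂sa,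
    hE₂idem, hE₂T, hE₂ι, hE₂K, hx, h𝒜conv, h𝒜star, h𝒜δ₁, h𝒜δ₂, hHS⟩ :=
    h hdiv μ_D W₁ W₂ hW₁ hW₂ h1 h1' he
  haveI := hμ
  exact not_isOrtho_of_testFamily η₁ η₂ ((AdelicGroupData.gl 2 K).rightRegular μ)
    ((AdelicGroupData.gl 2 K).isUnitary_rightRegular μ) ι₁
    (((AdelicGroupData.gl 2 K).isStronglyContinuous_rightRegular_holds μ).restrict ι₁ hι₁)
    (cuspidalSubspace 2 K μ)
    (fun N N' hN hN' hNirr hN'irr hNN' =>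
      eq_of_le_cuspidalSubspace_of_areUnitarilyEquivalent K 2 μ (hMO μ) N N' hN hN' hNirr hN'irr hNN')
    (fun U hU hU0 => exists_isTopIrreducible_le_of_le_cuspidalSubspace K 2 μ U hU hU0)
    Kset₁ hgen₁ E₁ hE₁sa hE₁idem hE₁T hE₁ι c₁ hE₁K M hM b c
    ((AdelicGroupData.units K D).rightRegular μ_D)
    ((AdelicGroupData.units K D).isUnitary_rightRegular μ_D) ι₂
    (((AdelicGroupData.units K D).isStronglyContinuous_rightRegular_holds μ_D).restrict ι₂ hι₂)
    Kset₂ hgen₂ E₂ hE₂sa hE₂idem hE₂T hE₂ι c₂ hE₂K 𝒜 h𝒜conv h𝒜star h𝒜δ₁ h𝒜δ₂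
    (fun a ha => (hHS a ha).1) (fun a ha => (hHS a ha).2) W₁ W₂ hW₁ hW₂ he hx

end Assembly

end Literature.NumberTheory.Automorphic
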